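/-
Copyright: the b2b-balaban T⁴-continuum CRUX team, row NE7b OWNER lineage `t4-ne7b-p1` (gen 131). Project licence.
-/
import Summits.QuantumFields.BalabanUV.T4Continuum.Spine.NE7b.SupStepLineDerivatives
import Summits.QuantumFields.BalabanUV.T4Continuum.Spine.NE7b.SupLogThirdDerivative

/-!
# THE THIRD-ORDER LETTER OF THE NEXT POTENTIAL ALONG A LINE: for the step `Z(t) = ∫e^{−V_t}dN(0,Γ)` along `ψ₀ + t·h` with `C³` remainders
# (letters `κ₀, κ₁, κ₂, κ₃`), `W⁺ = −log Z` is `C³` along the line and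
#   `|(log Z)‴(t₀)| ≤ E₃ + 3E₁E₂ + 2E₁³`,  `E₁ = κ₁Σ_Y|h|·L₁`,  `E₂ = κ₁²#YΣ_Yh²·L₂ + κ₂Σh²`,  `E₃ = κ₁³#Y²Σ|h|³·L₃ + 3κ₂Σh²·κ₁Σ|h|L₁ + κ₃Σ|h|³`,
# where `L_k` bound the single-site tilted moments `E_ν|u_x|^k` (`u_x = ω_x + ψ₀,x + t₀h_x`) of the tilted law `ν ∝ e^{−V_{t₀}}dN(0,Γ)` — THE CUBIC
# LETTER of the next remainder in the direction `h`, honestly O(1)·‖h‖³ on the same sites ((336b)'s `Z′, Z″, Z‴` + (337a)'s quotient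
# bookkeeping and power means; the `L_k` are HYPOTHESES here, discharged on the road by (329)∕(332a)'s single-site letters)
# (row NE7b, node U5c; (336a,b)∕(337a)∕(297)∕(313) BY NAME; [folklore])

Cell `pub-balaban`, sub-cell `t4`, spine estimate NE7b (`T4WeightBudget.RelWeightBound`; the cell's OWN estimate — NOT PRINTED in
[Bałaban 1983–89], NOT PROVED).  Crux-route work under `Spine/NE7b/` by the row OWNER (`t4-ne7b-p1` gen 131, file (337b)) under FREEZE
(0)'s crux-prover clause, on § [NE7bP1-G130-HANDOFF] NEXT (3)(a) ∕ ADDENDUM; NOTHING of Bałaban's is named as a Lean object, valued or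
asserted; no `T4Continuum/Support` leaf typed; no `def`, no notation; zero `sorry`.  Imports (BY NAME): the OWNER's (336b)
`…SupStepLineDerivatives` (`hasDerivAt_lineZ∕Z'∕Z''`), (336a) `…SupLinePointwise` (`abs_lineB_le`, `abs_lineC_le`), (337a)
`…SupLogThirdDerivative` (`hasDerivAt_log_of`, `hasDerivAt_logDeriv_of`, `hasDerivAt_logSecond_of`, `abs_logThird_le`, `abs_lin_le∕_sq_le∕_cube_le`),
(297) (`integrable_exp_neg`), (313) (`mul_opBound_le_of_le`); Mathlib's `abs_integral_le_integral_abs`, `integral_mono_of_nonneg`,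
`integral_finsetSum`, `integral_const_mul`, `integral_exp_pos`.

WHAT IS PROVED ([folklore]):
* §1 abstract letters: `quot_letter` (`|P| ≤ G ≤ Z·E`, `Z > 0` ⟹ `|P|∕Z ≤ E`), `abs_integral_div_le_of_dominated` (`|Φ| ≤ G` pointwise,
  `G` integrable, `∫G ≤ Z·E` ⟹ `|∫Φ|∕Z ≤ E`), `weighted_sum_letter` (`Σ_Y c_x·F_x` is integrable and `∫Σc_xF_x ≤ Z·((Σc_x)·L)` when
  `c_x ≥ 0`, `∫F_x ≤ Z·L`), and the three pointwise majorants `pointwise_Z1`, `pointwise_Z2`, `pointwise_Z3` of the integrands of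
  `Z′, Z″, Z‴` (`|e^{−V}(−A)| ≤ Σ(κ₁|h_x|)(e^{−V}|u_x|)`, …, from (337a)'s power means and (336a)'s `|B| ≤ κ₂Σh²`, `|C| ≤ κ₃Σ|h|³`);
* §2 the three expectation letters on the road's step: `lineZ_pos` (`Z(t₀) > 0`), **`abs_Z1_div_le`** (`|Z′|∕Z ≤ E₁`), **`abs_Z2_div_le`**
  (`|Z″|∕Z ≤ E₂`), **`abs_Z3_div_le`** (`|Z‴|∕Z ≤ E₃`), each under the single-site tilted moment letters `L_k` as hypotheses;
* §3 THE END: `logZ_derivs_line` (`(log Z)′ = Z′∕Z` and `(Z′∕Z)′ = (Z″Z − Z′Z′)∕Z²` at EVERY `t` — `log Z` is `C²` along the line with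
  the displayed derivatives) and **`third_letter_line`** (`HasDerivAt` of `(Z″Z − Z′Z′)∕Z²` at `t₀` with value `(Z‴Z² − 3ZZ′Z″ + 2Z′³)∕Z³`
  ∧ `|that| ≤ E₃ + 3E₁E₂ + 2E₁³`): `t ↦ W⁺(ψ₀ + th) = −log Z(t)` is `C³` with the cubic letter; §4 toy.

HONEST (what this is NOT).  The single-site moment letters `L₁, L₂, L₃` (and the integrability of `e^{−V}|u_x|^k`) are hypotheses — on the road
they are (329)'s `tilted_mean_le_of_supSmall` with `φ = |·|^k ≤ a_ke^{δ₀v²}` under KP smallness; the letter is O(1)·(Σ|h|)³: on the same sites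
without blocking there is NO contraction of the cubic constant; the Taylor glue to the remainder's smallness letter is the successor's ((290)
pattern); scalar skeleton ((A3), NC-NE7b-α UNRULED); nothing of Bałaban's asserted.  BY-NAME EFFECT ON THE WALL: NONE.  NE7b NOT PRINTED ∕
NOT PROVED; spine PROVED 0∕9; rung (B)+1 — the programme's measures remain FINITE-torus statements; NOT the mass gap, NOT Clay.  HONEST
DEPENDENCY: continuum YM on T⁴ ⇐ BetaPertH ∧ nine spine estimates (0∕9 proved); BetaPertH ⇐ (D1) ∧ (D4) ∧ CAP+tail; G-an2-4 gates asym,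
D1 and NE2∕3∕4.
-/

set_option autoImplicit false

noncomputable section

namespace Summit.QuantumFields.BalabanUV.T4Continuum.NE7b.SupNextPotentialThirdLetter

open MeasureTheory ProbabilityTheory Finset Real
open scoped BigOperators
open SupStepLineDerivatives (hasDerivAt_lineZ hasDerivAt_lineZ' hasDerivAt_lineZ'')
open SupLinePointwise (abs_lineB_le abs_lineC_le)
open SupLogThirdDerivative (hasDerivAt_log_of hasDerivAt_logDeriv_of hasDerivAt_logSecond_of abs_logThird_le abs_lin_le abs_lin_sq_le
  abs_lin_cube_le)
open SupEffectiveActionDerivative (mul_opBound_le_of_le)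
open SupFluctuationAPriori (integrable_exp_neg)

/-! ## §1. Abstract letters -/

section Abstract

variable {Ω : Type*} [MeasurableSpace Ω] {μ : Measure Ω}

/-- **The quotient letter**: `|P| ≤ G ≤ Z·E`, `Z > 0` ⟹ `|P|∕Z ≤ E`. [folklore] -/
theorem quot_letter {P G Z E : ℝ} (hZ : 0 < Z) (h1 : |P| ≤ G) (h2 : G ≤ Z * E) : |P| / Z ≤ E := by
  rw [div_le_iff₀ hZ]
  linarith [mul_comm Z E]

/-- **Dominated quotient**: `|Φ| ≤ G` pointwise, `G` integrable, `∫G ≤ Z·E`, `Z > 0` ⟹ `|∫Φ|∕Z ≤ E` (no integrability of `Φ` needed). [folklore] -/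
theorem abs_integral_div_le_of_dominated {Φ G : Ω → ℝ} {Z E : ℝ} (hZ : 0 < Z) (hG : Integrable G μ) (hdom : ∀ ω, |Φ ω| ≤ G ω)
    (hGE : ∫ ω, G ω ∂μ ≤ Z * E) : |∫ ω, Φ ω ∂μ| / Z ≤ E :=
  quot_letter hZ ((abs_integral_le_integral_abs).trans
    (integral_mono_of_nonneg (ae_of_all _ fun ω => abs_nonneg (Φ ω)) hG (ae_of_all _ hdom))) hGE

/-- **The weighted-sum letter**: `c_x ≥ 0`, `F_x` integrable with `∫F_x ≤ Z·L` (`x ∈ Y`) ⟹ `Σ_Y c_xF_x` is integrable and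
`∫Σ_Y c_xF_x ≤ Z·((Σ_Y c_x)·L)`. [folklore] -/
theorem weighted_sum_letter {ι : Type*} (Y : Finset ι) (c : ι → ℝ) (F : ι → Ω → ℝ) (hc : ∀ x ∈ Y, 0 ≤ c x)
    (hF : ∀ x ∈ Y, Integrable (F x) μ) {Z L : ℝ} (hL : ∀ x ∈ Y, ∫ ω, F x ω ∂μ ≤ Z * L) :
    Integrable (fun ω => ∑ x ∈ Y, c x * F x ω) μ ∧ ∫ ω, (∑ x ∈ Y, c x * F x ω) ∂μ ≤ Z * ((∑ x ∈ Y, c x) * L) := by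
  have hi : ∀ x ∈ Y, Integrable (fun ω => c x * F x ω) μ := fun x hx => (hF x hx).const_mul (c x)
  refine ⟨integrable_finsetSum Y hi, ?_⟩
  rw [integral_finsetSum Y hi]
  calc ∑ x ∈ Y, ∫ ω, c x * F x ω ∂μ = ∑ x ∈ Y, c x * ∫ ω, F x ω ∂μ := sum_congr rfl fun x _ => integral_const_mul _ _
    _ ≤ ∑ x ∈ Y, c x * (Z * L) := sum_le_sum fun x hx => mul_le_mul_of_nonneg_left (hL x hx) (hc x hx)
    _ = Z * ((∑ x ∈ Y, c x) * L) := by rw [← sum_mul]; ring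

end Abstract

/-! ### The three pointwise majorants (deterministic; `E > 0` stands for `e^{−V(ω)}`, `u_x` for the site fields) -/

section Pointwise

variable {ι : Type*} (Y : Finset ι) {w' : ι → ℝ → ℝ} {κ₁ κ₂ κ₃ : ℝ} (u h : ι → ℝ)

/-- `|E·(−A)| ≤ Σ_Y(κ₁|h_x|)·(E|u_x|)`. [folklore] -/
theorem pointwise_Z1 (hw'b : ∀ x v, |w' x v| ≤ κ₁ * |v|) {E : ℝ} (hE : 0 < E) :
    |E * -(∑ x ∈ Y, w' x (u x) * h x)| ≤ ∑ x ∈ Y, (κ₁ * |h x|) * (E * |u x|) := by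
  rw [abs_mul, abs_neg, abs_of_pos hE]
  calc E * |∑ x ∈ Y, w' x (u x) * h x| ≤ E * (κ₁ * ∑ x ∈ Y, |h x| * |u x|) :=
        mul_le_mul_of_nonneg_left (abs_lin_le Y u h hw'b) hE.le
    _ = ∑ x ∈ Y, (κ₁ * |h x|) * (E * |u x|) := by
        rw [mul_sum, mul_sum]
        exact sum_congr rfl fun x _ => by ring

/-- `|E·(A·A − B)| ≤ Σ_Y(κ₁²#Yh_x²)·(Eu_x²) + (κ₂Σh²)·E` when `|B| ≤ κ₂Σ_Yh²`. [folklore] -/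
theorem pointwise_Z2 (hκ₁ : 0 ≤ κ₁) (hw'b : ∀ x v, |w' x v| ≤ κ₁ * |v|) {B E : ℝ} (hB : |B| ≤ κ₂ * ∑ x ∈ Y, h x ^ 2) (hE : 0 < E) :
    |E * ((∑ x ∈ Y, w' x (u x) * h x) * (∑ x ∈ Y, w' x (u x) * h x) - B)| ≤
      ∑ x ∈ Y, (κ₁ ^ 2 * Y.card * h x ^ 2) * (E * u x ^ 2) + (κ₂ * ∑ x ∈ Y, h x ^ 2) * E := by
  rw [abs_mul, abs_of_pos hE]
  have h1 : |(∑ x ∈ Y, w' x (u x) * h x) * (∑ x ∈ Y, w' x (u x) * h x) - B| ≤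
      κ₁ ^ 2 * Y.card * (∑ x ∈ Y, h x ^ 2 * u x ^ 2) + κ₂ * ∑ x ∈ Y, h x ^ 2 := by
    refine (abs_sub _ _).trans ?_
    rw [abs_mul]
    linarith [abs_lin_sq_le Y u h hκ₁ hw'b]
  calc E * |(∑ x ∈ Y, w' x (u x) * h x) * (∑ x ∈ Y, w' x (u x) * h x) - B|
      ≤ E * (κ₁ ^ 2 * Y.card * (∑ x ∈ Y, h x ^ 2 * u x ^ 2) + κ₂ * ∑ x ∈ Y, h x ^ 2) := mul_le_mul_of_nonneg_left h1 hE.le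
    _ = ∑ x ∈ Y, (κ₁ ^ 2 * Y.card * h x ^ 2) * (E * u x ^ 2) + (κ₂ * ∑ x ∈ Y, h x ^ 2) * E := by
        have e : E * (κ₁ ^ 2 * Y.card * (∑ x ∈ Y, h x ^ 2 * u x ^ 2)) = ∑ x ∈ Y, (κ₁ ^ 2 * Y.card * h x ^ 2) * (E * u x ^ 2) := by
          rw [mul_sum, mul_sum]
          exact sum_congr rfl fun x _ => by ring
        rw [mul_add, e]
        ring

/-- `|E·(−A·A·A + 3AB − C)| ≤ Σ_Y(κ₁³#Y²|h_x|³)·(E|u_x|³) + Σ_Y(3κ₂Σh²·κ₁|h_x|)·(E|u_x|) + (κ₃Σ|h|³)·E` when `|B| ≤ κ₂Σh²`, `|C| ≤ κ₃Σ|h|³`.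
[folklore] -/
theorem pointwise_Z3 (hκ₁ : 0 ≤ κ₁) (hw'b : ∀ x v, |w' x v| ≤ κ₁ * |v|) {B C E : ℝ} (hB : |B| ≤ κ₂ * ∑ x ∈ Y, h x ^ 2)
    (hC : |C| ≤ κ₃ * ∑ x ∈ Y, |h x| ^ 3) (hE : 0 < E) :
    |E * (-((∑ x ∈ Y, w' x (u x) * h x) * (∑ x ∈ Y, w' x (u x) * h x) * (∑ x ∈ Y, w' x (u x) * h x)) +
        3 * ((∑ x ∈ Y, w' x (u x) * h x) * B) - C)| ≤
      ∑ x ∈ Y, (κ₁ ^ 3 * (Y.card : ℝ) ^ 2 * |h x| ^ 3) * (E * |u x| ^ 3) +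
        ∑ x ∈ Y, (3 * (κ₂ * ∑ x ∈ Y, h x ^ 2) * κ₁ * |h x|) * (E * |u x|) + (κ₃ * ∑ x ∈ Y, |h x| ^ 3) * E := by
  rw [abs_mul, abs_of_pos hE]
  have hA := abs_lin_le Y u h hw'b
  have hA3 := abs_lin_cube_le Y u h hκ₁ hw'b
  have hD0 : 0 ≤ κ₁ * ∑ x ∈ Y, |h x| * |u x| := mul_nonneg hκ₁ (sum_nonneg fun x _ => by positivity)
  have hAB : |∑ x ∈ Y, w' x (u x) * h x| * |B| ≤ (κ₁ * ∑ x ∈ Y, |h x| * |u x|) * (κ₂ * ∑ x ∈ Y, h x ^ 2) :=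
    mul_le_mul hA hB (abs_nonneg _) hD0
  have h1 : |-((∑ x ∈ Y, w' x (u x) * h x) * (∑ x ∈ Y, w' x (u x) * h x) * (∑ x ∈ Y, w' x (u x) * h x)) +
        3 * ((∑ x ∈ Y, w' x (u x) * h x) * B) - C| ≤
      κ₁ ^ 3 * (Y.card : ℝ) ^ 2 * (∑ x ∈ Y, |h x| ^ 3 * |u x| ^ 3) +
        3 * ((κ₁ * ∑ x ∈ Y, |h x| * |u x|) * (κ₂ * ∑ x ∈ Y, h x ^ 2)) + κ₃ * ∑ x ∈ Y, |h x| ^ 3 := by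
    have t1 := abs_sub (-((∑ x ∈ Y, w' x (u x) * h x) * (∑ x ∈ Y, w' x (u x) * h x) * (∑ x ∈ Y, w' x (u x) * h x)) +
        3 * ((∑ x ∈ Y, w' x (u x) * h x) * B)) C
    have t2 := abs_add_le (-((∑ x ∈ Y, w' x (u x) * h x) * (∑ x ∈ Y, w' x (u x) * h x) * (∑ x ∈ Y, w' x (u x) * h x)))
        (3 * ((∑ x ∈ Y, w' x (u x) * h x) * B))
    have e3 : |-((∑ x ∈ Y, w' x (u x) * h x) * (∑ x ∈ Y, w' x (u x) * h x) * (∑ x ∈ Y, w' x (u x) * h x))| =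
        |∑ x ∈ Y, w' x (u x) * h x| * |∑ x ∈ Y, w' x (u x) * h x| * |∑ x ∈ Y, w' x (u x) * h x| := by
      rw [abs_neg, abs_mul, abs_mul]
    have e4 : |3 * ((∑ x ∈ Y, w' x (u x) * h x) * B)| = 3 * (|∑ x ∈ Y, w' x (u x) * h x| * |B|) := by
      rw [abs_mul, abs_mul, abs_of_pos (by norm_num : (0 : ℝ) < 3)]
    linarith
  refine (mul_le_mul_of_nonneg_left h1 hE.le).trans (le_of_eq ?_)
  have e1 : E * (κ₁ ^ 3 * (Y.card : ℝ) ^ 2 * (∑ x ∈ Y, |h x| ^ 3 * |u x| ^ 3)) =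
      ∑ x ∈ Y, (κ₁ ^ 3 * (Y.card : ℝ) ^ 2 * |h x| ^ 3) * (E * |u x| ^ 3) := by
    rw [mul_sum, mul_sum]
    exact sum_congr rfl fun x _ => by ring
  have e2 : ∀ K : ℝ, ∑ x ∈ Y, (3 * K * κ₁ * |h x|) * (E * |u x|) = E * (3 * ((κ₁ * ∑ x ∈ Y, |h x| * |u x|) * K)) := by
    intro K
    have e0 : E * (3 * ((κ₁ * ∑ x ∈ Y, |h x| * |u x|) * K)) = (E * 3 * κ₁ * K) * ∑ x ∈ Y, |h x| * |u x| := by ring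
    rw [e0, mul_sum]
    exact sum_congr rfl fun x _ => by ring
  rw [mul_add, mul_add, e1, ← e2 (κ₂ * ∑ x ∈ Y, h x ^ 2)]
  ring

end Pointwise

/-! ## §2. The three expectation letters on the road's step -/

variable {ι : Type} [Fintype ι] [DecidableEq ι]

section Main

variable {Γ : Matrix ι ι ℝ} {γop : ℝ} {w w' w'' w₃ : ι → ℝ → ℝ} {κ₀ κ₁ κ₂ κ₃ τ δ θ : ℝ}

/-- `Z(t₀) = ∫e^{−V_{t₀}}dN(0,Γ) > 0` (the integrand is integrable by (297) and positive). [folklore] -/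
theorem lineZ_pos (hΓ : Γ.PosSemidef) (hΓop : (γop • (1 : Matrix ι ι ℝ) - Γ).PosSemidef) (Y : Finset ι) (hwm : ∀ x, Measurable (w x))
    (hκ₀ : 0 ≤ κ₀) (hτ : 0 < τ) (hθ1 : θ < 1) (hκθ₀ : 2 * κ₀ * (1 + τ) * γop ≤ θ) (hstab : ∀ x, ∀ u : ℝ, -(κ₀ * u ^ 2) ≤ w x u)
    (ψ₀ h : ι → ℝ) (t₀ : ℝ) :
    Integrable (fun ω : EuclideanSpace ℝ ι => exp (-(∑ x ∈ Y, w x (ω x + (ψ₀ x + t₀ * h x))))) (multivariateGaussian 0 Γ) ∧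
      0 < (∫ ω : EuclideanSpace ℝ ι, exp (-(∑ x ∈ Y, w x (ω x + (ψ₀ x + t₀ * h x)))) ∂(multivariateGaussian 0 Γ)) := by
  have hint : Integrable (fun ω : EuclideanSpace ℝ ι => exp (-(∑ x ∈ Y, w x (ω x + (ψ₀ x + t₀ * h x))))) (multivariateGaussian 0 Γ) :=
    integrable_exp_neg hΓ hΓop Y w hwm hκ₀ hτ hθ1 hκθ₀ hstab (fun x => ψ₀ x + t₀ * h x)
  exact ⟨hint, integral_exp_pos hint⟩

/-- **`|Z′|∕Z ≤ E₁ = κ₁Σ|h|L₁`**: `|∫e^{−V}(−A)| ≤ ∫e^{−V}|A| ≤ κ₁Σ_x|h_x|∫e^{−V}|u_x| ≤ Z·κ₁Σ|h|L₁`. [folklore] -/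
theorem abs_Z1_div_le (hΓ : Γ.PosSemidef) (hΓop : (γop • (1 : Matrix ι ι ℝ) - Γ).PosSemidef) (Y : Finset ι)
    (hwm : ∀ x, Measurable (w x)) (hκ₀ : 0 ≤ κ₀) (hκ₁ : 0 ≤ κ₁) (hτ : 0 < τ)
    (hθ1 : θ < 1) (hκθ₀ : 2 * κ₀ * (1 + τ) * γop ≤ θ) (hstab : ∀ x, ∀ u : ℝ, -(κ₀ * u ^ 2) ≤ w x u)
    (hw'b : ∀ x u, |w' x u| ≤ κ₁ * |u|) (ψ₀ h : ι → ℝ) (t₀ : ℝ)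
    {L₁ : ℝ}
    (hI1 : ∀ x ∈ Y, Integrable (fun ω : EuclideanSpace ℝ ι => exp (-(∑ x ∈ Y, w x (ω x + (ψ₀ x + t₀ * h x)))) * |(ω x + (ψ₀ x + t₀ * h x))|) (multivariateGaussian 0 Γ))
    (hL1 : ∀ x ∈ Y, ∫ ω : EuclideanSpace ℝ ι, exp (-(∑ x ∈ Y, w x (ω x + (ψ₀ x + t₀ * h x)))) * |(ω x + (ψ₀ x + t₀ * h x))| ∂(multivariateGaussian 0 Γ) ≤
      (∫ ω : EuclideanSpace ℝ ι, exp (-(∑ x ∈ Y, w x (ω x + (ψ₀ x + t₀ * h x)))) ∂(multivariateGaussian 0 Γ)) * L₁) :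
    |(∫ ω : EuclideanSpace ℝ ι, exp (-(∑ x ∈ Y, w x (ω x + (ψ₀ x + t₀ * h x)))) * -(∑ x ∈ Y, w' x (ω x + (ψ₀ x + t₀ * h x)) * h x) ∂(multivariateGaussian 0 Γ))| /
        (∫ ω : EuclideanSpace ℝ ι, exp (-(∑ x ∈ Y, w x (ω x + (ψ₀ x + t₀ * h x)))) ∂(multivariateGaussian 0 Γ)) ≤ (κ₁ * (∑ x ∈ Y, |h x|) * L₁) := by
  obtain ⟨hint, hZ⟩ := lineZ_pos hΓ hΓop Y hwm hκ₀ hτ hθ1 hκθ₀ hstab ψ₀ h t₀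
  have hW := weighted_sum_letter (μ := (multivariateGaussian 0 Γ)) Y (fun x => κ₁ * |h x|)
    (fun x => fun ω : EuclideanSpace ℝ ι => exp (-(∑ x ∈ Y, w x (ω x + (ψ₀ x + t₀ * h x)))) * |(ω x + (ψ₀ x + t₀ * h x))|)
    (fun x _ => mul_nonneg hκ₁ (abs_nonneg _)) hI1 hL1
  refine abs_integral_div_le_of_dominated (μ := (multivariateGaussian 0 Γ)) hZ hW.1 (fun ω => ?_) (hW.2.trans (le_of_eq ?_))
  · exact pointwise_Z1 Y (fun x => (ω x + (ψ₀ x + t₀ * h x))) h hw'b (exp_pos _)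
  · rw [← mul_sum]

/-- **`|Z″|∕Z ≤ E₂ = κ₁²#YΣh²L₂ + κ₂Σh²`**: `|A·A − B| ≤ |A|² + |B| ≤ κ₁²#YΣh_x²u_x² + κ₂Σh²`, integrated against `e^{−V}`. [folklore] -/
theorem abs_Z2_div_le (hΓ : Γ.PosSemidef) (hΓop : (γop • (1 : Matrix ι ι ℝ) - Γ).PosSemidef) (Y : Finset ι)
    (hwm : ∀ x, Measurable (w x)) (hκ₀ : 0 ≤ κ₀) (hκ₁ : 0 ≤ κ₁) (hτ : 0 < τ)
    (hθ1 : θ < 1) (hκθ₀ : 2 * κ₀ * (1 + τ) * γop ≤ θ) (hstab : ∀ x, ∀ u : ℝ, -(κ₀ * u ^ 2) ≤ w x u)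
    (hw'b : ∀ x u, |w' x u| ≤ κ₁ * |u|) (ψ₀ h : ι → ℝ) (t₀ : ℝ)
    (hw''b : ∀ x u, |w'' x u| ≤ κ₂) {L₂ : ℝ}
    (hI2 : ∀ x ∈ Y, Integrable (fun ω : EuclideanSpace ℝ ι => exp (-(∑ x ∈ Y, w x (ω x + (ψ₀ x + t₀ * h x)))) * (ω x + (ψ₀ x + t₀ * h x)) ^ 2) (multivariateGaussian 0 Γ))
    (hL2 : ∀ x ∈ Y, ∫ ω : EuclideanSpace ℝ ι, exp (-(∑ x ∈ Y, w x (ω x + (ψ₀ x + t₀ * h x)))) * (ω x + (ψ₀ x + t₀ * h x)) ^ 2 ∂(multivariateGaussian 0 Γ) ≤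
      (∫ ω : EuclideanSpace ℝ ι, exp (-(∑ x ∈ Y, w x (ω x + (ψ₀ x + t₀ * h x)))) ∂(multivariateGaussian 0 Γ)) * L₂) :
    |(∫ ω : EuclideanSpace ℝ ι, exp (-(∑ x ∈ Y, w x (ω x + (ψ₀ x + t₀ * h x)))) * ((∑ x ∈ Y, w' x (ω x + (ψ₀ x + t₀ * h x)) * h x) * (∑ x ∈ Y, w' x (ω x + (ψ₀ x + t₀ * h x)) * h x) - (∑ x ∈ Y, w'' x (ω x + (ψ₀ x + t₀ * h x)) * h x ^ 2)) ∂(multivariateGaussian 0 Γ))| /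
        (∫ ω : EuclideanSpace ℝ ι, exp (-(∑ x ∈ Y, w x (ω x + (ψ₀ x + t₀ * h x)))) ∂(multivariateGaussian 0 Γ)) ≤ (κ₁ ^ 2 * Y.card * (∑ x ∈ Y, h x ^ 2) * L₂ + κ₂ * (∑ x ∈ Y, h x ^ 2)) := by
  obtain ⟨hint, hZ⟩ := lineZ_pos hΓ hΓop Y hwm hκ₀ hτ hθ1 hκθ₀ hstab ψ₀ h t₀
  have hW := weighted_sum_letter (μ := (multivariateGaussian 0 Γ)) Y (fun x => κ₁ ^ 2 * Y.card * h x ^ 2)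
    (fun x => fun ω : EuclideanSpace ℝ ι => exp (-(∑ x ∈ Y, w x (ω x + (ψ₀ x + t₀ * h x)))) * (ω x + (ψ₀ x + t₀ * h x)) ^ 2)
    (fun x _ => by positivity) hI2 hL2
  have hK : Integrable (fun ω : EuclideanSpace ℝ ι => (κ₂ * (∑ x ∈ Y, h x ^ 2)) * exp (-(∑ x ∈ Y, w x (ω x + (ψ₀ x + t₀ * h x))))) (multivariateGaussian 0 Γ) := hint.const_mul _
  have hG : Integrable (fun ω : EuclideanSpace ℝ ι => (∑ x ∈ Y, (κ₁ ^ 2 * Y.card * h x ^ 2) * (exp (-(∑ x ∈ Y, w x (ω x + (ψ₀ x + t₀ * h x)))) * (ω x + (ψ₀ x + t₀ * h x)) ^ 2) + (κ₂ * (∑ x ∈ Y, h x ^ 2)) * exp (-(∑ x ∈ Y, w x (ω x + (ψ₀ x + t₀ * h x)))))) (multivariateGaussian 0 Γ) := hW.1.add hK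
  refine abs_integral_div_le_of_dominated (μ := (multivariateGaussian 0 Γ)) hZ hG (fun ω => ?_) ?_
  · exact pointwise_Z2 Y (fun x => (ω x + (ψ₀ x + t₀ * h x))) h hκ₁ hw'b (abs_lineB_le Y (fun x => ω x) ψ₀ h hw''b t₀) (exp_pos _)
  · have hadd := integral_add hW.1 hK
    rw [hadd, integral_const_mul]
    have h2 := hW.2
    have e : (∫ ω : EuclideanSpace ℝ ι, exp (-(∑ x ∈ Y, w x (ω x + (ψ₀ x + t₀ * h x)))) ∂(multivariateGaussian 0 Γ)) * (κ₁ ^ 2 * Y.card * (∑ x ∈ Y, h x ^ 2) * L₂ + κ₂ * (∑ x ∈ Y, h x ^ 2)) =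
        (∫ ω : EuclideanSpace ℝ ι, exp (-(∑ x ∈ Y, w x (ω x + (ψ₀ x + t₀ * h x)))) ∂(multivariateGaussian 0 Γ)) * ((∑ x ∈ Y, κ₁ ^ 2 * Y.card * h x ^ 2) * L₂) +
          (κ₂ * (∑ x ∈ Y, h x ^ 2)) * (∫ ω : EuclideanSpace ℝ ι, exp (-(∑ x ∈ Y, w x (ω x + (ψ₀ x + t₀ * h x)))) ∂(multivariateGaussian 0 Γ)) := by
      rw [← mul_sum]
      ring
    rw [e]
    linarith

/-- **`|Z‴|∕Z ≤ E₃ = κ₁³#Y²Σ|h|³L₃ + 3κ₂Σh²·κ₁Σ|h|L₁ + κ₃Σ|h|³`**: `|−A³ + 3AB − C| ≤ |A|³ + 3|A||B| + |C|` under the power means and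
(336a)'s `|B| ≤ κ₂Σh²`, `|C| ≤ κ₃Σ|h|³`, integrated against `e^{−V}`. [folklore] -/
theorem abs_Z3_div_le (hΓ : Γ.PosSemidef) (hΓop : (γop • (1 : Matrix ι ι ℝ) - Γ).PosSemidef) (Y : Finset ι)
    (hwm : ∀ x, Measurable (w x)) (hκ₀ : 0 ≤ κ₀) (hκ₁ : 0 ≤ κ₁) (hτ : 0 < τ)
    (hθ1 : θ < 1) (hκθ₀ : 2 * κ₀ * (1 + τ) * γop ≤ θ) (hstab : ∀ x, ∀ u : ℝ, -(κ₀ * u ^ 2) ≤ w x u)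
    (hw'b : ∀ x u, |w' x u| ≤ κ₁ * |u|) (ψ₀ h : ι → ℝ) (t₀ : ℝ)
    (hw''b : ∀ x u, |w'' x u| ≤ κ₂) (hw₃b : ∀ x u, |w₃ x u| ≤ κ₃) (hκ₂ : 0 ≤ κ₂) {L₁ L₃ : ℝ}
    (hI1 : ∀ x ∈ Y, Integrable (fun ω : EuclideanSpace ℝ ι => exp (-(∑ x ∈ Y, w x (ω x + (ψ₀ x + t₀ * h x)))) * |(ω x + (ψ₀ x + t₀ * h x))|) (multivariateGaussian 0 Γ))
    (hL1 : ∀ x ∈ Y, ∫ ω : EuclideanSpace ℝ ι, exp (-(∑ x ∈ Y, w x (ω x + (ψ₀ x + t₀ * h x)))) * |(ω x + (ψ₀ x + t₀ * h x))| ∂(multivariateGaussian 0 Γ) ≤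
      (∫ ω : EuclideanSpace ℝ ι, exp (-(∑ x ∈ Y, w x (ω x + (ψ₀ x + t₀ * h x)))) ∂(multivariateGaussian 0 Γ)) * L₁)
    (hI3 : ∀ x ∈ Y, Integrable (fun ω : EuclideanSpace ℝ ι => exp (-(∑ x ∈ Y, w x (ω x + (ψ₀ x + t₀ * h x)))) * |(ω x + (ψ₀ x + t₀ * h x))| ^ 3) (multivariateGaussian 0 Γ))
    (hL3 : ∀ x ∈ Y, ∫ ω : EuclideanSpace ℝ ι, exp (-(∑ x ∈ Y, w x (ω x + (ψ₀ x + t₀ * h x)))) * |(ω x + (ψ₀ x + t₀ * h x))| ^ 3 ∂(multivariateGaussian 0 Γ) ≤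
      (∫ ω : EuclideanSpace ℝ ι, exp (-(∑ x ∈ Y, w x (ω x + (ψ₀ x + t₀ * h x)))) ∂(multivariateGaussian 0 Γ)) * L₃) :
    |(∫ ω : EuclideanSpace ℝ ι, exp (-(∑ x ∈ Y, w x (ω x + (ψ₀ x + t₀ * h x)))) * (-((∑ x ∈ Y, w' x (ω x + (ψ₀ x + t₀ * h x)) * h x) * (∑ x ∈ Y, w' x (ω x + (ψ₀ x + t₀ * h x)) * h x) * (∑ x ∈ Y, w' x (ω x + (ψ₀ x + t₀ * h x)) * h x)) + 3 * ((∑ x ∈ Y, w' x (ω x + (ψ₀ x + t₀ * h x)) * h x) * (∑ x ∈ Y, w'' x (ω x + (ψ₀ x + t₀ * h x)) * h x ^ 2)) - (∑ x ∈ Y, w₃ x (ω x + (ψ₀ x + t₀ * h x)) * h x ^ 3)) ∂(multivariateGaussian 0 Γ))| /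
        (∫ ω : EuclideanSpace ℝ ι, exp (-(∑ x ∈ Y, w x (ω x + (ψ₀ x + t₀ * h x)))) ∂(multivariateGaussian 0 Γ)) ≤
      (κ₁ ^ 3 * (Y.card : ℝ) ^ 2 * (∑ x ∈ Y, |h x| ^ 3) * L₃ + 3 * (κ₂ * (∑ x ∈ Y, h x ^ 2)) * (κ₁ * (∑ x ∈ Y, |h x|) * L₁) + κ₃ * (∑ x ∈ Y, |h x| ^ 3)) := by
  obtain ⟨hint, hZ⟩ := lineZ_pos hΓ hΓop Y hwm hκ₀ hτ hθ1 hκθ₀ hstab ψ₀ h t₀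
  have hH2 : 0 ≤ (∑ x ∈ Y, h x ^ 2) := sum_nonneg fun x _ => sq_nonneg _
  have hW3 := weighted_sum_letter (μ := (multivariateGaussian 0 Γ)) Y (fun x => κ₁ ^ 3 * (Y.card : ℝ) ^ 2 * |h x| ^ 3)
    (fun x => fun ω : EuclideanSpace ℝ ι => exp (-(∑ x ∈ Y, w x (ω x + (ψ₀ x + t₀ * h x)))) * |(ω x + (ψ₀ x + t₀ * h x))| ^ 3)
    (fun x _ => by positivity) hI3 hL3
  have hW1 := weighted_sum_letter (μ := (multivariateGaussian 0 Γ)) Y (fun x => 3 * (κ₂ * (∑ x ∈ Y, h x ^ 2)) * κ₁ * |h x|)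
    (fun x => fun ω : EuclideanSpace ℝ ι => exp (-(∑ x ∈ Y, w x (ω x + (ψ₀ x + t₀ * h x)))) * |(ω x + (ψ₀ x + t₀ * h x))|)
    (fun x _ => by positivity) hI1 hL1
  have hK : Integrable (fun ω : EuclideanSpace ℝ ι => (κ₃ * (∑ x ∈ Y, |h x| ^ 3)) * exp (-(∑ x ∈ Y, w x (ω x + (ψ₀ x + t₀ * h x))))) (multivariateGaussian 0 Γ) := hint.const_mul _
  have hG12 : Integrable (fun ω : EuclideanSpace ℝ ι => ∑ x ∈ Y, (κ₁ ^ 3 * (Y.card : ℝ) ^ 2 * |h x| ^ 3) * (exp (-(∑ x ∈ Y, w x (ω x + (ψ₀ x + t₀ * h x)))) * |(ω x + (ψ₀ x + t₀ * h x))| ^ 3) + ∑ x ∈ Y, (3 * (κ₂ * (∑ x ∈ Y, h x ^ 2)) * κ₁ * |h x|) * (exp (-(∑ x ∈ Y, w x (ω x + (ψ₀ x + t₀ * h x)))) * |(ω x + (ψ₀ x + t₀ * h x))|)) (multivariateGaussian 0 Γ) := hW3.1.add hW1.1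
  have hG : Integrable (fun ω : EuclideanSpace ℝ ι => (∑ x ∈ Y, (κ₁ ^ 3 * (Y.card : ℝ) ^ 2 * |h x| ^ 3) * (exp (-(∑ x ∈ Y, w x (ω x + (ψ₀ x + t₀ * h x)))) * |(ω x + (ψ₀ x + t₀ * h x))| ^ 3) + ∑ x ∈ Y, (3 * (κ₂ * (∑ x ∈ Y, h x ^ 2)) * κ₁ * |h x|) * (exp (-(∑ x ∈ Y, w x (ω x + (ψ₀ x + t₀ * h x)))) * |(ω x + (ψ₀ x + t₀ * h x))|) + (κ₃ * (∑ x ∈ Y, |h x| ^ 3)) * exp (-(∑ x ∈ Y, w x (ω x + (ψ₀ x + t₀ * h x)))))) (multivariateGaussian 0 Γ) := hG12.add hK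
  refine abs_integral_div_le_of_dominated (μ := (multivariateGaussian 0 Γ)) hZ hG (fun ω => ?_) ?_
  · exact pointwise_Z3 Y (fun x => (ω x + (ψ₀ x + t₀ * h x))) h hκ₁ hw'b (abs_lineB_le Y (fun x => ω x) ψ₀ h hw''b t₀)
      (abs_lineC_le Y (fun x => ω x) ψ₀ h hw₃b t₀) (exp_pos _)
  · have hadd := integral_add hG12 hK
    have hadd' := integral_add hW3.1 hW1.1
    rw [hadd, hadd', integral_const_mul]
    have h3 := hW3.2
    have h1 := hW1.2
    have e : (∫ ω : EuclideanSpace ℝ ι, exp (-(∑ x ∈ Y, w x (ω x + (ψ₀ x + t₀ * h x)))) ∂(multivariateGaussian 0 Γ)) *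
          (κ₁ ^ 3 * (Y.card : ℝ) ^ 2 * (∑ x ∈ Y, |h x| ^ 3) * L₃ + 3 * (κ₂ * (∑ x ∈ Y, h x ^ 2)) * (κ₁ * (∑ x ∈ Y, |h x|) * L₁) + κ₃ * (∑ x ∈ Y, |h x| ^ 3)) =
        (∫ ω : EuclideanSpace ℝ ι, exp (-(∑ x ∈ Y, w x (ω x + (ψ₀ x + t₀ * h x)))) ∂(multivariateGaussian 0 Γ)) * ((∑ x ∈ Y, κ₁ ^ 3 * (Y.card : ℝ) ^ 2 * |h x| ^ 3) * L₃) +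
          (∫ ω : EuclideanSpace ℝ ι, exp (-(∑ x ∈ Y, w x (ω x + (ψ₀ x + t₀ * h x)))) ∂(multivariateGaussian 0 Γ)) * ((∑ x ∈ Y, 3 * (κ₂ * (∑ x ∈ Y, h x ^ 2)) * κ₁ * |h x|) * L₁) +
          (κ₃ * (∑ x ∈ Y, |h x| ^ 3)) * (∫ ω : EuclideanSpace ℝ ι, exp (-(∑ x ∈ Y, w x (ω x + (ψ₀ x + t₀ * h x)))) ∂(multivariateGaussian 0 Γ)) := by
      rw [← mul_sum, ← mul_sum]
      ring
    rw [e]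
    linarith

/-! ## §3. THE END: `log Z` is `C³` along the line with the cubic letter -/

/-- **`log Z` is `C²` along every line with `(log Z)′ = Z′∕Z`, `(Z′∕Z)′ = (Z″Z − Z′Z′)∕Z²` at EVERY `t`** ((336b) + (337a) §1). [folklore] -/
theorem logZ_derivs_line (hΓ : Γ.PosSemidef) (hΓop : (γop • (1 : Matrix ι ι ℝ) - Γ).PosSemidef) (Y : Finset ι)
    (hw' : ∀ x t, HasDerivAt (w x) (w' x t) t) (hw'' : ∀ x t, HasDerivAt (w' x) (w'' x t) t) (hw₃ : ∀ x t, HasDerivAt (w'' x) (w₃ x t) t)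
    (hw₃m : ∀ x, Measurable (w₃ x)) (hκ₀ : 0 ≤ κ₀) (hκ₁ : 0 ≤ κ₁) (hκ₂ : 0 ≤ κ₂) (hκ₃ : 0 ≤ κ₃) (hτ : 0 < τ) (hδ : 0 < δ) (hθ0 : 0 ≤ θ)
    (hθ1 : θ < 1) (hκθ : (2 * κ₀ * (1 + τ) + 4 * δ) * γop ≤ θ) (hstab : ∀ x, ∀ u : ℝ, -(κ₀ * u ^ 2) ≤ w x u)
    (hw'b : ∀ x u, |w' x u| ≤ κ₁ * |u|) (hw''b : ∀ x u, |w'' x u| ≤ κ₂) (hw₃b : ∀ x u, |w₃ x u| ≤ κ₃) (ψ₀ h : ι → ℝ) (t₀ : ℝ) :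
    HasDerivAt (fun t : ℝ => Real.log (∫ ω : EuclideanSpace ℝ ι, exp (-(∑ x ∈ Y, w x (ω x + (ψ₀ x + t * h x)))) ∂(multivariateGaussian 0 Γ)))
        ((∫ ω : EuclideanSpace ℝ ι, exp (-(∑ x ∈ Y, w x (ω x + (ψ₀ x + t₀ * h x)))) * -(∑ x ∈ Y, w' x (ω x + (ψ₀ x + t₀ * h x)) * h x) ∂(multivariateGaussian 0 Γ)) /
          (∫ ω : EuclideanSpace ℝ ι, exp (-(∑ x ∈ Y, w x (ω x + (ψ₀ x + t₀ * h x)))) ∂(multivariateGaussian 0 Γ))) t₀ ∧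
      HasDerivAt (fun t : ℝ => (∫ ω : EuclideanSpace ℝ ι, exp (-(∑ x ∈ Y, w x (ω x + (ψ₀ x + t * h x)))) * -(∑ x ∈ Y, w' x (ω x + (ψ₀ x + t * h x)) * h x) ∂(multivariateGaussian 0 Γ)) /
          (∫ ω : EuclideanSpace ℝ ι, exp (-(∑ x ∈ Y, w x (ω x + (ψ₀ x + t * h x)))) ∂(multivariateGaussian 0 Γ)))
        (((∫ ω : EuclideanSpace ℝ ι, exp (-(∑ x ∈ Y, w x (ω x + (ψ₀ x + t₀ * h x)))) * ((∑ x ∈ Y, w' x (ω x + (ψ₀ x + t₀ * h x)) * h x) * (∑ x ∈ Y, w' x (ω x + (ψ₀ x + t₀ * h x)) * h x) - (∑ x ∈ Y, w'' x (ω x + (ψ₀ x + t₀ * h x)) * h x ^ 2)) ∂(multivariateGaussian 0 Γ)) *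
            (∫ ω : EuclideanSpace ℝ ι, exp (-(∑ x ∈ Y, w x (ω x + (ψ₀ x + t₀ * h x)))) ∂(multivariateGaussian 0 Γ)) -
          (∫ ω : EuclideanSpace ℝ ι, exp (-(∑ x ∈ Y, w x (ω x + (ψ₀ x + t₀ * h x)))) * -(∑ x ∈ Y, w' x (ω x + (ψ₀ x + t₀ * h x)) * h x) ∂(multivariateGaussian 0 Γ)) *
            (∫ ω : EuclideanSpace ℝ ι, exp (-(∑ x ∈ Y, w x (ω x + (ψ₀ x + t₀ * h x)))) * -(∑ x ∈ Y, w' x (ω x + (ψ₀ x + t₀ * h x)) * h x) ∂(multivariateGaussian 0 Γ))) /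
          (∫ ω : EuclideanSpace ℝ ι, exp (-(∑ x ∈ Y, w x (ω x + (ψ₀ x + t₀ * h x)))) ∂(multivariateGaussian 0 Γ)) ^ 2) t₀ := by
  have hwm : ∀ x, Measurable (w x) := fun x => (continuous_iff_continuousAt.2 fun u => (hw' x u).continuousAt).measurable
  have hκθ₀ : 2 * κ₀ * (1 + τ) * γop ≤ θ :=
    mul_opBound_le_of_le (a := 2 * κ₀ * (1 + τ)) (b := 2 * κ₀ * (1 + τ) + 4 * δ) (by positivity) (by linarith [hδ.le]) hθ0 hκθ
  have hZ := (lineZ_pos hΓ hΓop Y hwm hκ₀ hτ hθ1 hκθ₀ hstab ψ₀ h t₀).2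
  have hd1 := (hasDerivAt_lineZ hΓ hΓop Y hw' hw'' hw₃ hw₃m hκ₀ hκ₁ hκ₂ hκ₃ hτ hδ hθ0 hθ1 hκθ hstab hw'b hw''b hw₃b ψ₀ h t₀).2
  have hd2 := (hasDerivAt_lineZ' hΓ hΓop Y hw' hw'' hw₃ hw₃m hκ₀ hκ₁ hκ₂ hκ₃ hτ hδ hθ0 hθ1 hκθ hstab hw'b hw''b hw₃b ψ₀ h t₀).2
  exact ⟨hasDerivAt_log_of (Z := fun t : ℝ => (∫ ω : EuclideanSpace ℝ ι, exp (-(∑ x ∈ Y, w x (ω x + (ψ₀ x + t * h x)))) ∂(multivariateGaussian 0 Γ)))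
      (Z₁ := fun t : ℝ => (∫ ω : EuclideanSpace ℝ ι, exp (-(∑ x ∈ Y, w x (ω x + (ψ₀ x + t * h x)))) * -(∑ x ∈ Y, w' x (ω x + (ψ₀ x + t * h x)) * h x) ∂(multivariateGaussian 0 Γ))) hd1 hZ,
    hasDerivAt_logDeriv_of (Z := fun t : ℝ => (∫ ω : EuclideanSpace ℝ ι, exp (-(∑ x ∈ Y, w x (ω x + (ψ₀ x + t * h x)))) ∂(multivariateGaussian 0 Γ)))
      (Z₁ := fun t : ℝ => (∫ ω : EuclideanSpace ℝ ι, exp (-(∑ x ∈ Y, w x (ω x + (ψ₀ x + t * h x)))) * -(∑ x ∈ Y, w' x (ω x + (ψ₀ x + t * h x)) * h x) ∂(multivariateGaussian 0 Γ)))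
      (Z₂ := fun t : ℝ => (∫ ω : EuclideanSpace ℝ ι, exp (-(∑ x ∈ Y, w x (ω x + (ψ₀ x + t * h x)))) * ((∑ x ∈ Y, w' x (ω x + (ψ₀ x + t * h x)) * h x) * (∑ x ∈ Y, w' x (ω x + (ψ₀ x + t * h x)) * h x) - (∑ x ∈ Y, w'' x (ω x + (ψ₀ x + t * h x)) * h x ^ 2)) ∂(multivariateGaussian 0 Γ))) hd1 hd2 hZ⟩

/-- **THE THIRD-ORDER LETTER OF THE NEXT POTENTIAL ALONG A LINE.**  Under (336b)'s hypotheses (`Γ ⪰ 0`, `Γ ⪯ γ_op·1`, `C³` remainders with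
`−κ₀u² ≤ w`, `|w′| ≤ κ₁|u|`, `|w″| ≤ κ₂`, `|w‴| ≤ κ₃`, `0 < τ, δ`, `0 ≤ θ < 1`, `(2κ₀(1+τ)+4δ)γ_op ≤ θ`) and the single-site tilted moment
letters `∫e^{−V}|u_x| ≤ Z·L₁`, `∫e^{−V}u_x² ≤ Z·L₂`, `∫e^{−V}|u_x|³ ≤ Z·L₃` (`x ∈ Y`): the second derivative of `log Z` along `ψ₀ + t·h`,
`(Z″Z − Z′Z′)∕Z²`, is differentiable at `t₀` with derivative `(Z‴Z² − 3ZZ′Z″ + 2Z′³)∕Z³`, and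
`|(log Z)‴(t₀)| ≤ E₃ + 3E₁E₂ + 2E₁³` — the cubic letter of `W⁺ = −log Z` in the direction `h`. [folklore] -/
theorem third_letter_line (hΓ : Γ.PosSemidef) (hΓop : (γop • (1 : Matrix ι ι ℝ) - Γ).PosSemidef) (Y : Finset ι)
    (hw' : ∀ x t, HasDerivAt (w x) (w' x t) t) (hw'' : ∀ x t, HasDerivAt (w' x) (w'' x t) t) (hw₃ : ∀ x t, HasDerivAt (w'' x) (w₃ x t) t)
    (hw₃m : ∀ x, Measurable (w₃ x)) (hκ₀ : 0 ≤ κ₀) (hκ₁ : 0 ≤ κ₁) (hκ₂ : 0 ≤ κ₂) (hκ₃ : 0 ≤ κ₃) (hτ : 0 < τ) (hδ : 0 < δ) (hθ0 : 0 ≤ θ)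
    (hθ1 : θ < 1) (hκθ : (2 * κ₀ * (1 + τ) + 4 * δ) * γop ≤ θ) (hstab : ∀ x, ∀ u : ℝ, -(κ₀ * u ^ 2) ≤ w x u)
    (hw'b : ∀ x u, |w' x u| ≤ κ₁ * |u|) (hw''b : ∀ x u, |w'' x u| ≤ κ₂) (hw₃b : ∀ x u, |w₃ x u| ≤ κ₃) (ψ₀ h : ι → ℝ) (t₀ : ℝ)
    {L₁ L₂ L₃ : ℝ}
    (hI1 : ∀ x ∈ Y, Integrable (fun ω : EuclideanSpace ℝ ι => exp (-(∑ x ∈ Y, w x (ω x + (ψ₀ x + t₀ * h x)))) * |(ω x + (ψ₀ x + t₀ * h x))|) (multivariateGaussian 0 Γ))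
    (hL1 : ∀ x ∈ Y, ∫ ω : EuclideanSpace ℝ ι, exp (-(∑ x ∈ Y, w x (ω x + (ψ₀ x + t₀ * h x)))) * |(ω x + (ψ₀ x + t₀ * h x))| ∂(multivariateGaussian 0 Γ) ≤
      (∫ ω : EuclideanSpace ℝ ι, exp (-(∑ x ∈ Y, w x (ω x + (ψ₀ x + t₀ * h x)))) ∂(multivariateGaussian 0 Γ)) * L₁)
    (hI2 : ∀ x ∈ Y, Integrable (fun ω : EuclideanSpace ℝ ι => exp (-(∑ x ∈ Y, w x (ω x + (ψ₀ x + t₀ * h x)))) * (ω x + (ψ₀ x + t₀ * h x)) ^ 2) (multivariateGaussian 0 Γ))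
    (hL2 : ∀ x ∈ Y, ∫ ω : EuclideanSpace ℝ ι, exp (-(∑ x ∈ Y, w x (ω x + (ψ₀ x + t₀ * h x)))) * (ω x + (ψ₀ x + t₀ * h x)) ^ 2 ∂(multivariateGaussian 0 Γ) ≤
      (∫ ω : EuclideanSpace ℝ ι, exp (-(∑ x ∈ Y, w x (ω x + (ψ₀ x + t₀ * h x)))) ∂(multivariateGaussian 0 Γ)) * L₂)
    (hI3 : ∀ x ∈ Y, Integrable (fun ω : EuclideanSpace ℝ ι => exp (-(∑ x ∈ Y, w x (ω x + (ψ₀ x + t₀ * h x)))) * |(ω x + (ψ₀ x + t₀ * h x))| ^ 3) (multivariateGaussian 0 Γ))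
    (hL3 : ∀ x ∈ Y, ∫ ω : EuclideanSpace ℝ ι, exp (-(∑ x ∈ Y, w x (ω x + (ψ₀ x + t₀ * h x)))) * |(ω x + (ψ₀ x + t₀ * h x))| ^ 3 ∂(multivariateGaussian 0 Γ) ≤
      (∫ ω : EuclideanSpace ℝ ι, exp (-(∑ x ∈ Y, w x (ω x + (ψ₀ x + t₀ * h x)))) ∂(multivariateGaussian 0 Γ)) * L₃) :
    HasDerivAt (fun t : ℝ => ((∫ ω : EuclideanSpace ℝ ι, exp (-(∑ x ∈ Y, w x (ω x + (ψ₀ x + t * h x)))) * ((∑ x ∈ Y, w' x (ω x + (ψ₀ x + t * h x)) * h x) * (∑ x ∈ Y, w' x (ω x + (ψ₀ x + t * h x)) * h x) - (∑ x ∈ Y, w'' x (ω x + (ψ₀ x + t * h x)) * h x ^ 2)) ∂(multivariateGaussian 0 Γ)) *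
            (∫ ω : EuclideanSpace ℝ ι, exp (-(∑ x ∈ Y, w x (ω x + (ψ₀ x + t * h x)))) ∂(multivariateGaussian 0 Γ)) -
          (∫ ω : EuclideanSpace ℝ ι, exp (-(∑ x ∈ Y, w x (ω x + (ψ₀ x + t * h x)))) * -(∑ x ∈ Y, w' x (ω x + (ψ₀ x + t * h x)) * h x) ∂(multivariateGaussian 0 Γ)) *
            (∫ ω : EuclideanSpace ℝ ι, exp (-(∑ x ∈ Y, w x (ω x + (ψ₀ x + t * h x)))) * -(∑ x ∈ Y, w' x (ω x + (ψ₀ x + t * h x)) * h x) ∂(multivariateGaussian 0 Γ))) /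
          (∫ ω : EuclideanSpace ℝ ι, exp (-(∑ x ∈ Y, w x (ω x + (ψ₀ x + t * h x)))) ∂(multivariateGaussian 0 Γ)) ^ 2)
        (((∫ ω : EuclideanSpace ℝ ι, exp (-(∑ x ∈ Y, w x (ω x + (ψ₀ x + t₀ * h x)))) * (-((∑ x ∈ Y, w' x (ω x + (ψ₀ x + t₀ * h x)) * h x) * (∑ x ∈ Y, w' x (ω x + (ψ₀ x + t₀ * h x)) * h x) * (∑ x ∈ Y, w' x (ω x + (ψ₀ x + t₀ * h x)) * h x)) + 3 * ((∑ x ∈ Y, w' x (ω x + (ψ₀ x + t₀ * h x)) * h x) * (∑ x ∈ Y, w'' x (ω x + (ψ₀ x + t₀ * h x)) * h x ^ 2)) - (∑ x ∈ Y, w₃ x (ω x + (ψ₀ x + t₀ * h x)) * h x ^ 3)) ∂(multivariateGaussian 0 Γ)) *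
            (∫ ω : EuclideanSpace ℝ ι, exp (-(∑ x ∈ Y, w x (ω x + (ψ₀ x + t₀ * h x)))) ∂(multivariateGaussian 0 Γ)) ^ 2 -
          3 * (∫ ω : EuclideanSpace ℝ ι, exp (-(∑ x ∈ Y, w x (ω x + (ψ₀ x + t₀ * h x)))) ∂(multivariateGaussian 0 Γ)) *
            (∫ ω : EuclideanSpace ℝ ι, exp (-(∑ x ∈ Y, w x (ω x + (ψ₀ x + t₀ * h x)))) * -(∑ x ∈ Y, w' x (ω x + (ψ₀ x + t₀ * h x)) * h x) ∂(multivariateGaussian 0 Γ)) *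
            (∫ ω : EuclideanSpace ℝ ι, exp (-(∑ x ∈ Y, w x (ω x + (ψ₀ x + t₀ * h x)))) * ((∑ x ∈ Y, w' x (ω x + (ψ₀ x + t₀ * h x)) * h x) * (∑ x ∈ Y, w' x (ω x + (ψ₀ x + t₀ * h x)) * h x) - (∑ x ∈ Y, w'' x (ω x + (ψ₀ x + t₀ * h x)) * h x ^ 2)) ∂(multivariateGaussian 0 Γ)) +
          2 * (∫ ω : EuclideanSpace ℝ ι, exp (-(∑ x ∈ Y, w x (ω x + (ψ₀ x + t₀ * h x)))) * -(∑ x ∈ Y, w' x (ω x + (ψ₀ x + t₀ * h x)) * h x) ∂(multivariateGaussian 0 Γ)) ^ 3) /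
          (∫ ω : EuclideanSpace ℝ ι, exp (-(∑ x ∈ Y, w x (ω x + (ψ₀ x + t₀ * h x)))) ∂(multivariateGaussian 0 Γ)) ^ 3) t₀ ∧
      |((∫ ω : EuclideanSpace ℝ ι, exp (-(∑ x ∈ Y, w x (ω x + (ψ₀ x + t₀ * h x)))) * (-((∑ x ∈ Y, w' x (ω x + (ψ₀ x + t₀ * h x)) * h x) * (∑ x ∈ Y, w' x (ω x + (ψ₀ x + t₀ * h x)) * h x) * (∑ x ∈ Y, w' x (ω x + (ψ₀ x + t₀ * h x)) * h x)) + 3 * ((∑ x ∈ Y, w' x (ω x + (ψ₀ x + t₀ * h x)) * h x) * (∑ x ∈ Y, w'' x (ω x + (ψ₀ x + t₀ * h x)) * h x ^ 2)) - (∑ x ∈ Y, w₃ x (ω x + (ψ₀ x + t₀ * h x)) * h x ^ 3)) ∂(multivariateGaussian 0 Γ)) *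
            (∫ ω : EuclideanSpace ℝ ι, exp (-(∑ x ∈ Y, w x (ω x + (ψ₀ x + t₀ * h x)))) ∂(multivariateGaussian 0 Γ)) ^ 2 -
          3 * (∫ ω : EuclideanSpace ℝ ι, exp (-(∑ x ∈ Y, w x (ω x + (ψ₀ x + t₀ * h x)))) ∂(multivariateGaussian 0 Γ)) *
            (∫ ω : EuclideanSpace ℝ ι, exp (-(∑ x ∈ Y, w x (ω x + (ψ₀ x + t₀ * h x)))) * -(∑ x ∈ Y, w' x (ω x + (ψ₀ x + t₀ * h x)) * h x) ∂(multivariateGaussian 0 Γ)) *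
            (∫ ω : EuclideanSpace ℝ ι, exp (-(∑ x ∈ Y, w x (ω x + (ψ₀ x + t₀ * h x)))) * ((∑ x ∈ Y, w' x (ω x + (ψ₀ x + t₀ * h x)) * h x) * (∑ x ∈ Y, w' x (ω x + (ψ₀ x + t₀ * h x)) * h x) - (∑ x ∈ Y, w'' x (ω x + (ψ₀ x + t₀ * h x)) * h x ^ 2)) ∂(multivariateGaussian 0 Γ)) +
          2 * (∫ ω : EuclideanSpace ℝ ι, exp (-(∑ x ∈ Y, w x (ω x + (ψ₀ x + t₀ * h x)))) * -(∑ x ∈ Y, w' x (ω x + (ψ₀ x + t₀ * h x)) * h x) ∂(multivariateGaussian 0 Γ)) ^ 3) /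
          (∫ ω : EuclideanSpace ℝ ι, exp (-(∑ x ∈ Y, w x (ω x + (ψ₀ x + t₀ * h x)))) ∂(multivariateGaussian 0 Γ)) ^ 3| ≤
        (κ₁ ^ 3 * (Y.card : ℝ) ^ 2 * (∑ x ∈ Y, |h x| ^ 3) * L₃ + 3 * (κ₂ * (∑ x ∈ Y, h x ^ 2)) * (κ₁ * (∑ x ∈ Y, |h x|) * L₁) + κ₃ * (∑ x ∈ Y, |h x| ^ 3)) +
          3 * (κ₁ * (∑ x ∈ Y, |h x|) * L₁) * (κ₁ ^ 2 * Y.card * (∑ x ∈ Y, h x ^ 2) * L₂ + κ₂ * (∑ x ∈ Y, h x ^ 2)) + 2 * (κ₁ * (∑ x ∈ Y, |h x|) * L₁) ^ 3 := by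
  have hwm : ∀ x, Measurable (w x) := fun x => (continuous_iff_continuousAt.2 fun u => (hw' x u).continuousAt).measurable
  have hκθ₀ : 2 * κ₀ * (1 + τ) * γop ≤ θ :=
    mul_opBound_le_of_le (a := 2 * κ₀ * (1 + τ)) (b := 2 * κ₀ * (1 + τ) + 4 * δ) (by positivity) (by linarith [hδ.le]) hθ0 hκθ
  have hZ := (lineZ_pos hΓ hΓop Y hwm hκ₀ hτ hθ1 hκθ₀ hstab ψ₀ h t₀).2
  have hd1 := (hasDerivAt_lineZ hΓ hΓop Y hw' hw'' hw₃ hw₃m hκ₀ hκ₁ hκ₂ hκ₃ hτ hδ hθ0 hθ1 hκθ hstab hw'b hw''b hw₃b ψ₀ h t₀).2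
  have hd2 := (hasDerivAt_lineZ' hΓ hΓop Y hw' hw'' hw₃ hw₃m hκ₀ hκ₁ hκ₂ hκ₃ hτ hδ hθ0 hθ1 hκθ hstab hw'b hw''b hw₃b ψ₀ h t₀).2
  have hd3 := (hasDerivAt_lineZ'' hΓ hΓop Y hw' hw'' hw₃ hw₃m hκ₀ hκ₁ hκ₂ hκ₃ hτ hδ hθ0 hθ1 hκθ hstab hw'b hw''b hw₃b ψ₀ h t₀).2
  refine ⟨hasDerivAt_logSecond_of (Z := fun t : ℝ => (∫ ω : EuclideanSpace ℝ ι, exp (-(∑ x ∈ Y, w x (ω x + (ψ₀ x + t * h x)))) ∂(multivariateGaussian 0 Γ)))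
      (Z₁ := fun t : ℝ => (∫ ω : EuclideanSpace ℝ ι, exp (-(∑ x ∈ Y, w x (ω x + (ψ₀ x + t * h x)))) * -(∑ x ∈ Y, w' x (ω x + (ψ₀ x + t * h x)) * h x) ∂(multivariateGaussian 0 Γ)))
      (Z₂ := fun t : ℝ => (∫ ω : EuclideanSpace ℝ ι, exp (-(∑ x ∈ Y, w x (ω x + (ψ₀ x + t * h x)))) * ((∑ x ∈ Y, w' x (ω x + (ψ₀ x + t * h x)) * h x) * (∑ x ∈ Y, w' x (ω x + (ψ₀ x + t * h x)) * h x) - (∑ x ∈ Y, w'' x (ω x + (ψ₀ x + t * h x)) * h x ^ 2)) ∂(multivariateGaussian 0 Γ)))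
      (z₃ := (∫ ω : EuclideanSpace ℝ ι, exp (-(∑ x ∈ Y, w x (ω x + (ψ₀ x + t₀ * h x)))) * (-((∑ x ∈ Y, w' x (ω x + (ψ₀ x + t₀ * h x)) * h x) * (∑ x ∈ Y, w' x (ω x + (ψ₀ x + t₀ * h x)) * h x) * (∑ x ∈ Y, w' x (ω x + (ψ₀ x + t₀ * h x)) * h x)) + 3 * ((∑ x ∈ Y, w' x (ω x + (ψ₀ x + t₀ * h x)) * h x) * (∑ x ∈ Y, w'' x (ω x + (ψ₀ x + t₀ * h x)) * h x ^ 2)) - (∑ x ∈ Y, w₃ x (ω x + (ψ₀ x + t₀ * h x)) * h x ^ 3)) ∂(multivariateGaussian 0 Γ))) hd1 hd2 hd3 hZ, ?_⟩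
  have e1 := abs_Z1_div_le hΓ hΓop Y hwm hκ₀ hκ₁ hτ hθ1 hκθ₀ hstab hw'b ψ₀ h t₀ hI1 hL1
  have e2 := abs_Z2_div_le hΓ hΓop Y hwm hκ₀ hκ₁ hτ hθ1 hκθ₀ hstab hw'b ψ₀ h t₀ hw''b hI2 hL2
  have e3 := abs_Z3_div_le hΓ hΓop Y hwm hκ₀ hκ₁ hτ hθ1 hκθ₀ hstab hw'b ψ₀ h t₀ hw''b hw₃b hκ₂ hI1 hL1 hI3 hL3
  have n1 : 0 ≤ |(∫ ω : EuclideanSpace ℝ ι, exp (-(∑ x ∈ Y, w x (ω x + (ψ₀ x + t₀ * h x)))) * -(∑ x ∈ Y, w' x (ω x + (ψ₀ x + t₀ * h x)) * h x) ∂(multivariateGaussian 0 Γ))| /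
      (∫ ω : EuclideanSpace ℝ ι, exp (-(∑ x ∈ Y, w x (ω x + (ψ₀ x + t₀ * h x)))) ∂(multivariateGaussian 0 Γ)) := by positivity
  have n2 : 0 ≤ |(∫ ω : EuclideanSpace ℝ ι, exp (-(∑ x ∈ Y, w x (ω x + (ψ₀ x + t₀ * h x)))) * ((∑ x ∈ Y, w' x (ω x + (ψ₀ x + t₀ * h x)) * h x) * (∑ x ∈ Y, w' x (ω x + (ψ₀ x + t₀ * h x)) * h x) - (∑ x ∈ Y, w'' x (ω x + (ψ₀ x + t₀ * h x)) * h x ^ 2)) ∂(multivariateGaussian 0 Γ))| /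
      (∫ ω : EuclideanSpace ℝ ι, exp (-(∑ x ∈ Y, w x (ω x + (ψ₀ x + t₀ * h x)))) ∂(multivariateGaussian 0 Γ)) := by positivity
  have hE1 : 0 ≤ (κ₁ * (∑ x ∈ Y, |h x|) * L₁) := n1.trans e1
  refine (abs_logThird_le hZ).trans ?_
  have p12 : (|(∫ ω : EuclideanSpace ℝ ι, exp (-(∑ x ∈ Y, w x (ω x + (ψ₀ x + t₀ * h x)))) * -(∑ x ∈ Y, w' x (ω x + (ψ₀ x + t₀ * h x)) * h x) ∂(multivariateGaussian 0 Γ))| /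
        (∫ ω : EuclideanSpace ℝ ι, exp (-(∑ x ∈ Y, w x (ω x + (ψ₀ x + t₀ * h x)))) ∂(multivariateGaussian 0 Γ))) *
      (|(∫ ω : EuclideanSpace ℝ ι, exp (-(∑ x ∈ Y, w x (ω x + (ψ₀ x + t₀ * h x)))) * ((∑ x ∈ Y, w' x (ω x + (ψ₀ x + t₀ * h x)) * h x) * (∑ x ∈ Y, w' x (ω x + (ψ₀ x + t₀ * h x)) * h x) - (∑ x ∈ Y, w'' x (ω x + (ψ₀ x + t₀ * h x)) * h x ^ 2)) ∂(multivariateGaussian 0 Γ))| /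
        (∫ ω : EuclideanSpace ℝ ι, exp (-(∑ x ∈ Y, w x (ω x + (ψ₀ x + t₀ * h x)))) ∂(multivariateGaussian 0 Γ))) ≤ (κ₁ * (∑ x ∈ Y, |h x|) * L₁) * (κ₁ ^ 2 * Y.card * (∑ x ∈ Y, h x ^ 2) * L₂ + κ₂ * (∑ x ∈ Y, h x ^ 2)) := mul_le_mul e1 e2 n2 hE1
  have p13 : (|(∫ ω : EuclideanSpace ℝ ι, exp (-(∑ x ∈ Y, w x (ω x + (ψ₀ x + t₀ * h x)))) * -(∑ x ∈ Y, w' x (ω x + (ψ₀ x + t₀ * h x)) * h x) ∂(multivariateGaussian 0 Γ))| /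
        (∫ ω : EuclideanSpace ℝ ι, exp (-(∑ x ∈ Y, w x (ω x + (ψ₀ x + t₀ * h x)))) ∂(multivariateGaussian 0 Γ))) ^ 3 ≤ (κ₁ * (∑ x ∈ Y, |h x|) * L₁) ^ 3 := pow_le_pow_left₀ n1 e1 3
  linarith

end Main

/-! ## §4. Toy -/

/-- Toy (§1's quotient letter): `|P| ≤ 2 ≤ 4·(1∕2)` with `Z = 4` gives `|P|∕4 ≤ 1∕2`. -/
example (P : ℝ) (hP : |P| ≤ 2) : |P| / 4 ≤ 1 / 2 := quot_letter (by norm_num) hP (by norm_num)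

end Summit.QuantumFields.BalabanUV.T4Continuum.NE7b.SupNextPotentialThirdLetter
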